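import Literature.Computability.Learning.DPDecodeFP
import HarnessLib

/-!
# The hypothesis evaluator of the CIKK learner in `FP`

Machine-layer instalment (M7) of the decomposition of the named fact
`Literature.Computability.Learning.cikk_natural_implies_learning` (CIKK 2016, Thm. 5.1): the
evaluator `E(h, x)` of the learner's hypotheses. A hypothesis string is the record
`hypRec …` of one run's data (predictor record with the tables of `AMP(f)` restricted to the
design, GL seeds and guesses, trusted positions / tuple / TRUE values, sampling steps); the
evaluator is `evalFn dR = decodeFn (candVecFn (predFn dR))`, in `FP` for every decision
procedure `dR ∈ FP` of the property, and on a genuine record it computes exactly the run's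
hypothesis `runHyp (learnerDesign …) (natTest R ℓ) f ω` (`NaturalLearningRun.lean`).

## References

* M. Carmosino, R. Impagliazzo, V. Kabanets, A. Kolokolova, *Learning algorithms from natural
  proofs*, CCC 2016, §5 (complete algorithm) and Thm. 5.1
  [CarmosinoImpagliazzoKabanetsKolokolova2016].
-/

open Polynomial

namespace Literature.Computability.Learning

open Literature.Computability.Complexity Literature.Computability.Complexity.Brick
  Literature.Computability.Complexity.DirectProduct Literature.Computability.MetaComplexity
  Literature.Computability.Cryptography _root_.Computability

/-- **The evaluator** `E`: DP decoder ∘ GL stage ∘ table-based NW predictor, with the decision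
procedure `dR` of the property. [cite: CarmosinoImpagliazzoKabanetsKolokolova2016, §5 (steps 3–5)] -/
noncomputable def evalFn (dR : List Bool → List Bool) : List Bool → List Bool :=
  decodeFn (candVecFn (predFn dR))

/-- **`evalFn dR ∈ FP`** for `dR ∈ FP`. [cite: CarmosinoImpagliazzoKabanetsKolokolova2016, Thm. 5.1 (running time)] -/
theorem evalFn_mem_FP {dR : List Bool → List Bool} (hdR : dR ∈ FP) : evalFn dR ∈ FP :=
  decodeFn_mem_FP (candVecFn_mem_FP (predFn_mem_FP hdR))

/-- `evalFn dR` is one-bit. [folklore] -/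
theorem oneBit_evalFn (dR : List Bool → List Bool) : OneBit (evalFn dR) := oneBit_decodeFn _

/-- **The hypothesis record of one run** with coins `ω = ((i, z, w), (sd, σ), (Pb, a, steps))`:
the DP record over the GL record over the predictor record (tables `tbls`, trusted values
`f ∘ a`). [cite: CarmosinoImpagliazzoKabanetsKolokolova2016, §5] -/
def hypRec (pad : List Bool) (q n k ℓ kk t : ℕ) (tbls : List (List Bool)) (f : (Fin n → Bool) → Bool)
    (ω : RunCoins n k (2 ^ ℓ) (q * q) kk t) : List Bool :=
  dpRec (glRec (predRec (predHdr pad q ℓ (k * n + k) (2 ^ ℓ)) (List.ofFn ((boolFunEquivFin ℓ).symm ω.1.1))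
      (List.ofFn ω.1.2.2) (OracleCompose.body tbls) (List.ofFn ω.1.2.1)) n k kk (seedBits ω.2.1.1)
      (List.ofFn fun t => zmodToBool (ω.2.1.2 t)))
    n k t (List.ofFn ω.2.2.1) (tupleBits ω.2.2.2.1) (List.ofFn (f ∘ ω.2.2.2.1)) (stepsCode ω.2.2.2.2)

/-- **The evaluator computes the run's hypothesis.** If the stored tables are the tables of
`AMP(f)` for the challenge block `i` and seed `z`, then
`evalFn dR ⟨hypRec …, x⟩ = [runHyp (learnerDesign …) (natTest R ℓ) f ω x]`.
[cite: CarmosinoImpagliazzoKabanetsKolokolova2016, §5 (complete algorithm) and Thm. 5.1] -/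
theorem evalFn_apply {q n k ℓ kk t : ℕ} [Fact q.Prime] (hn : k * n + k ≤ q) (R : CombinatorialProperty)
    {dR : List Bool → List Bool} (hdR : ∀ y, dR y = encodeBool ((truthTableLanguage R).boolIndicator y))
    (pad : List Bool) (f : (Fin n → Bool) → Bool) (ω : RunCoins n k (2 ^ ℓ) (q * q) kk t) (tbls : List (List Bool))
    (htbls : ∀ j : Fin (2 ^ ℓ), (j : ℕ) < ω.1.1 → tbls.getD j [] = tableList (learnerDesign q n k ℓ hn) (ampFnFin f k) q ω.1.1 j ω.1.2.1)
    (x : Fin n → Bool) :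
    evalFn dR (boolPair (hypRec pad q n k ℓ kk t tbls f ω) (List.ofFn x)) =
      [runHyp (learnerDesign q n k ℓ hn) (natTest R ℓ) f ω x] := by
  rw [evalFn, hypRec, runHyp, decodeFn_apply (glStage (nwStage (learnerDesign q n k ℓ hn) (natTest R ℓ) f ω.1) ω.2.1)]
  intro xs
  rw [show ω.2.1 = (ω.2.1.1, ω.2.1.2) from rfl]
  exact candVecFn_apply _ (fun u => predFn_eq_nwPredictor hn R hdR pad (ampFnFin f k) ω.1.1 ω.1.2.1 ω.1.2.2 u tbls htbls)
    ω.2.1.1 ω.2.1.2 xs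

end Literature.Computability.Learning
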